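import Mathlib
import Summits.Ventures.PercRepro2.CoinTreeCore
import Summits.Ventures.PercRepro2.CoinOrTailKDefs
import Summits.Ventures.PercRepro2.CoinChainTower
import Summits.Ventures.PercRepro2.CoinChainTowerMarkerCoins

/-!
# The marker at the bottom vertex of a tower with random entry coins: an instantiation
(blind cell PercRepro2, night-2 g18; NIGHT2-DARC.md §58.8)

Sixteen coins on `Fin 10` (s = 0, m₂ = 1, q = 2, r = 3, v₁ = 4, v₂ = 5, a = 6, h = 7, w = 8,
t = 9): the out-tree core `s → m₂`, `s → q`, `q → r`; the bottom tower vertex `v₁` entered from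
the THREE core vertices `m₂, q, r` by random coins (two of them non-markers — no covering theorem
applies), `v₂` entered from `v₁` and `m₂`, the free-arc vertex `a` entered from `v₂` and `m₂`;
the head `v₁ → h → t`, `r → h`, `v₂ → t`, `a → t`, `w → t`.  Row 2′DARC at `a → w` for the markers
`(v₁, m₂)` for EVERY probability vector, no hypothesis (`darc_towerMarkerV₁_coins_example`).
-/

namespace Summit.Ventures.PercRepro2.Coin

namespace TowerMarkerCoinsExample

open Classical

/-- The sixteen coins of the example. -/
def arcsTM : Fin 16 → Finset (Fin 10 × Fin 10)
  | 0 => {(0, 1)}   -- s → m₂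
  | 1 => {(0, 2)}   -- s → q
  | 2 => {(2, 3)}   -- q → r
  | 3 => {(1, 4)}   -- m₂ → v₁
  | 4 => {(2, 4)}   -- q → v₁
  | 5 => {(3, 4)}   -- r → v₁
  | 6 => {(4, 5)}   -- v₁ → v₂
  | 7 => {(1, 5)}   -- m₂ → v₂
  | 8 => {(5, 6)}   -- v₂ → a
  | 9 => {(1, 6)}   -- m₂ → a
  | 10 => {(4, 7)}  -- v₁ → h
  | 11 => {(7, 9)}  -- h → t
  | 12 => {(6, 9)}  -- a → t
  | 13 => {(8, 9)}  -- w → t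
  | 14 => {(5, 9)}  -- v₂ → t
  | 15 => {(3, 7)}  -- r → h
  | _ => ∅

/-- The entry coins of `v₁`. -/
def c₁TM : Fin 10 → Fin 16
  | 1 => 3
  | 2 => 4
  | 3 => 5
  | _ => 0

/-- The entry coins of `v₂`. -/
def c₂TM : Fin 10 → Fin 16
  | 4 => 6
  | 1 => 7
  | _ => 0

/-- The entry coins of `a`. -/
def cTM : Fin 10 → Fin 16
  | 5 => 8
  | 1 => 9
  | _ => 0

/-- The tree coins. -/
def tcTM : Fin 10 → Fin 16
  | 1 => 0
  | 2 => 1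
  | 3 => 2
  | _ => 0

/-- The parent map. -/
def parTM : Fin 10 → Fin 10
  | 3 => 2
  | _ => 0

/-- The rank. -/
def rkTM : Fin 10 → ℕ
  | 1 => 1
  | 2 => 1
  | 3 => 2
  | _ => 0

/-- Every coin is a single arc. -/
lemma sameEnds_tm : SameEnds arcsTM := by
  intro e xy hxy x'y' hx'y'
  fin_cases e <;> simp [arcsTM] at hxy hx'y' <;> subst hxy <;> subst hx'y' <;>
    exact ⟨Or.inl rfl, Or.inr rfl⟩

set_option maxRecDepth 20000 in
/-- The out-tree core `{m₂, q, r}`. -/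
lemma treeCore_tm : TreeCore arcsTM 0 {1, 2, 3} tcTM parTM rkTM where
  tree := by decide
  par_mem := by decide
  rank := by decide
  into_C := by decide
  into_s := by decide
  s_notin := by decide

set_option maxRecDepth 20000 in
/-- `v₁ = 4` is an OR-vertex of the core entered from `m₂, q, r`. -/
lemma orTailK₁_tm : OrTailK arcsTM 0 {1, 2, 3} {1, 2, 3} c₁TM 4 where
  ent_sub := by decide
  s_notin := by decide
  a_notin := by decide
  a_ne_s := by decide
  into_U := by decide
  into_s := by decide
  into_a := by decide
  arcs_c := by decide
  c_inj := by decide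

set_option maxRecDepth 20000 in
/-- `v₂ = 5` is an OR-vertex of `U ∪ {v₁}` entered from `v₁` and `m₂`. -/
lemma orTailK₂_tm : OrTailK arcsTM 0 (insert 4 {1, 2, 3}) {4, 1} c₂TM 5 where
  ent_sub := by decide
  s_notin := by decide
  a_notin := by decide
  a_ne_s := by decide
  into_U := by decide
  into_s := by decide
  into_a := by decide
  arcs_c := by decide
  c_inj := by decide

set_option maxRecDepth 20000 in
/-- `a = 6` is an OR-vertex of `U ∪ {v₁, v₂}` entered from `v₂` and `m₂`. -/
lemma orTailK_tm : OrTailK arcsTM 0 (insert 5 (insert 4 {1, 2, 3})) {5, 1} cTM 6 where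
  ent_sub := by decide
  s_notin := by decide
  a_notin := by decide
  a_ne_s := by decide
  into_U := by decide
  into_s := by decide
  into_a := by decide
  arcs_c := by decide
  c_inj := by decide

/-- The tower `[v₂]` over `U ∪ {v₁}`. -/
lemma orTower_tm : OrTower arcsTM 0 (insert 4 {1, 2, 3}) [({4, 1}, c₂TM, 5)] :=
  OrTower.cons _ _ _ _ _ orTailK₂_tm (OrTower.nil _)

/-- **Row 2′DARC at `a → w` for the markers `(v₁, m₂)` on the sixteen-coin instance, every
probability vector — no hypothesis** (three random entry coins at `v₁`, two of them from
non-marker core vertices). -/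
theorem darc_towerMarkerV₁_coins_example {R : Type*} [Field R] [LinearOrder R]
    [IsStrictOrderedRing R] (pr : Fin 16 → R) (hp : IsProbVec pr) :
    DARC pr arcsTM 0 {9} 4 1 6 8 :=
  darc_of_towerTreeMarkerV₁_coins pr hp sameEnds_tm orTailK₁_tm orTower_tm orTailK_tm treeCore_tm
    (by decide)
    (by
      intro x hx
      simp only [List.mem_cons, List.not_mem_nil, or_false] at hx
      subst hx; decide)
    (by decide) (by decide) (by decide) (by decide) (by decide)

end TowerMarkerCoinsExample

end Summit.Ventures.PercRepro2.Coin
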